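import Mathlib.Algebra.Polynomial.Roots
import Mathlib.Data.Nat.Log
import Literature.Computability.AlgebraicComplexity.TauConjectureProofs
import Summits.ValiantsHypothesis.ValiantsHypothesis.Theses.IntegralOrbits

/-!
# Crux `IntegralOrbits.TauBurgisserDet` (stmt-ValiantsHypothesis-7680), line `registered` —
# stub `stub_tauEndgame`: the τ-endgame at quasi-polylogarithmic cost

The last five lines of Bürgisser's proof of Thm. 1.1(2) (ECCC TR06-113, p. 15; journal: Main
Thm. 1.2), re-run with an integer multiplier `N ≠ 0`, a power `d ≥ 1` and one more logarithm.
Assume the Shub–Smale τ-conjecture (route item `TauConjecture`: a nonzero `f ∈ ℤ[X]` has at most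
`(τ(f) + 2)^{c₀}` distinct integer roots) and a bound
`τ(N · (2^e · f_n)^d) ≤ 2^((log₂ log₂ n + c)^c)` for all `n ≥ n₁`, where
`f_n = ∏_{k=1}^{n} (X - k)` is the Pochhammer–Wilkinson polynomial (`pochhammerWilkinson`).  The
polynomial `g_n = N · (2^e · f_n)^d` is nonzero and divisible by `f_n`, so it has at least the `n`
distinct integer roots `1, …, n` (`card_roots_toFinset_pochhammerWilkinson`,
`Polynomial.roots.le_of_dvd`); the τ-conjecture then forces
`n ≤ (2^((log₂ log₂ n + c)^c) + 2)^{c₀}` for all `n ≥ n₁`, which fails at `n = 2^(2^k)` for `k`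
large, because `c₀ · ((k + c)^c + 2) < 2^k` eventually (polynomial versus exponential growth,
from the tree's `exists_add_two_pow_lt_two_pow`).

References: P. Bürgisser, *On defining integers and proving arithmetic circuit lower bounds*,
Comput. Complexity 18 (2009), proof of Thm. 1.1(2); M. Shub, S. Smale, *On the intractability of
Hilbert's Nullstellensatz and an algebraic version of "NP ≠ P?"*, Duke Math. J. 81 (1995), §1.
-/

set_option linter.dupNamespace false

namespace Summit.ValiantsHypothesis.ValiantsHypothesis.Theorems.IntegralOrbitsTauBurgisserDet

open Polynomial
open Literature.Computability.AlgebraicComplexity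

/-- Growth lemma (polynomial versus exponential, with a prescribed lower bound on the witness):
for all `c, c₀, K` there is `k ≥ K` with `c₀ · ((k + c)^c + 2) < 2^k`.  From the tree's
`exists_add_two_pow_lt_two_pow` at the exponent `2c + 1 + c₀ + K + c`: its witness `m` satisfies
`(m + 2)^{2c+1+c₀+K+c} < 2^m`, whence `K, c < m` and
`c₀ ((m + c)^c + 2) ≤ (m+2)^{c₀} (m+2)^{2c+1}`. [folklore] -/
theorem tbd_exists_ge_mul_add_pow_lt_two_pow (c c₀ K : ℕ) :
    ∃ k : ℕ, K ≤ k ∧ c₀ * ((k + c) ^ c + 2) < 2 ^ k := by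
  obtain ⟨m, -, hm⟩ := exists_add_two_pow_lt_two_pow (2 * c + 1 + c₀ + K + c)
  have h2 : 2 ≤ m + 2 := by omega
  -- `K < m` and `c < m`
  have hpow : ∀ j, j ≤ 2 * c + 1 + c₀ + K + c → 2 ^ j < 2 ^ m := fun j hj =>
    calc 2 ^ j ≤ (m + 2) ^ j := Nat.pow_le_pow_left h2 j
      _ ≤ (m + 2) ^ (2 * c + 1 + c₀ + K + c) := Nat.pow_le_pow_right (by omega) hj
      _ < 2 ^ m := hm
  have hK : K < m := (Nat.pow_lt_pow_iff_right (by norm_num)).1 (hpow K (by omega))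
  have hc : c < m := (Nat.pow_lt_pow_iff_right (by norm_num)).1 (hpow c (by omega))
  refine ⟨m, hK.le, ?_⟩
  have hx : 1 ≤ (m + 2) ^ (2 * c) := Nat.one_le_pow _ _ (by omega)
  have h1 : (m + c) ^ c ≤ (m + 2) ^ (2 * c) := by
    rw [pow_mul]
    refine Nat.pow_le_pow_left ?_ c
    calc m + c ≤ 2 * (m + 2) := by omega
      _ ≤ (m + 2) * (m + 2) := Nat.mul_le_mul_right _ h2
      _ = (m + 2) ^ 2 := (sq _).symm
  have h1' : (m + c) ^ c + 2 ≤ (m + 2) ^ (2 * c + 1) :=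
    calc (m + c) ^ c + 2 ≤ (m + 2) ^ (2 * c) + 2 := Nat.add_le_add_right h1 2
      _ ≤ (m + 2) ^ (2 * c) * 3 := by omega
      _ ≤ (m + 2) ^ (2 * c) * (m + 2) := Nat.mul_le_mul_left _ (by omega)
      _ = (m + 2) ^ (2 * c + 1) := (pow_succ _ _).symm
  have h3 : c₀ ≤ (m + 2) ^ c₀ :=
    (Nat.lt_two_pow_self).le.trans (Nat.pow_le_pow_left h2 c₀)
  calc c₀ * ((m + c) ^ c + 2) ≤ (m + 2) ^ c₀ * (m + 2) ^ (2 * c + 1) := Nat.mul_le_mul h3 h1'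
    _ = (m + 2) ^ (c₀ + (2 * c + 1)) := (pow_add _ _ _).symm
    _ ≤ (m + 2) ^ (2 * c + 1 + c₀ + K + c) := Nat.pow_le_pow_right (by omega) (by omega)
    _ < 2 ^ m := hm

/-- Growth lemma at doubly exponential scale: for all `c, c₀, K` there is `k ≥ K` with
`(2^((k + c)^c) + 2)^{c₀} < 2^(2^k)` (bound `2^a + 2 ≤ 2^(a+2)` and use
`tbd_exists_ge_mul_add_pow_lt_two_pow`). [folklore] -/
theorem tbd_exists_ge_two_pow_pow_add_two_pow_lt (c c₀ K : ℕ) :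
    ∃ k : ℕ, K ≤ k ∧ (2 ^ ((k + c) ^ c) + 2) ^ c₀ < 2 ^ (2 ^ k) := by
  obtain ⟨k, hk, hlt⟩ := tbd_exists_ge_mul_add_pow_lt_two_pow c c₀ K
  refine ⟨k, hk, ?_⟩
  have h1 : 2 ^ ((k + c) ^ c) + 2 ≤ 2 ^ ((k + c) ^ c + 2) := by
    have : 1 ≤ 2 ^ ((k + c) ^ c) := Nat.one_le_two_pow
    rw [pow_add]
    omega
  calc (2 ^ ((k + c) ^ c) + 2) ^ c₀ ≤ (2 ^ ((k + c) ^ c + 2)) ^ c₀ := Nat.pow_le_pow_left h1 _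
    _ = 2 ^ (((k + c) ^ c + 2) * c₀) := (pow_mul _ _ _).symm
    _ < 2 ^ (2 ^ k) := Nat.pow_lt_pow_right (by norm_num) (by rwa [mul_comm])

/-- **Stub `stub_tauEndgame` — the τ-endgame at quasi-polylogarithmic cost** (Bürgisser 2009,
proof of Thm. 1.1(2), last five lines, re-run with `(N, d)` and one more logarithm).  The
Shub–Smale τ-conjecture (route item `TauConjecture`) is incompatible with a bound
`τ(N · (2^e · f_n)^d) ≤ 2^((log₂ log₂ n + c)^c)` (`N ≠ 0`, `d ≥ 1`) for all large `n` on the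
Pochhammer–Wilkinson polynomials `f_n = ∏_{k=1}^{n} (X - k)`: `g_n = N · (2^e · f_n)^d ≠ 0` is
divisible by `f_n`, so it has at least `n` distinct integer roots, and the τ-conjecture gives
`n ≤ (τ(g_n) + 2)^{c₀} ≤ (2^((log₂ log₂ n + c)^c) + 2)^{c₀}` for all `n ≥ n₁` — false at
`n = 2^(2^k)` for `k ≥ n₁` large (`tbd_exists_ge_two_pow_pow_add_two_pow_lt`).
[cite: Burgisser2009, proof of Thm. 1.1(2)] [cite: ShubSmale1995, §1] -/
theorem stub_tauEndgame :
    Summit.ValiantsHypothesis.ValiantsHypothesis.Theses.IntegralOrbits.TauConjecture →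
      (∃ c n₁ : ℕ, ∀ n ≥ n₁, ∃ (N : ℤ) (e d : ℕ), N ≠ 0 ∧ 1 ≤ d ∧
          Literature.Computability.AlgebraicComplexity.tauPoly
              (Polynomial.C N * (Polynomial.C ((2 : ℤ) ^ e) *
                Literature.Computability.AlgebraicComplexity.pochhammerWilkinson n) ^ d) ≤
            2 ^ ((Nat.log 2 (Nat.log 2 n) + c) ^ c)) →
      False := by
  intro hτ h
  obtain ⟨c₀, hc₀⟩ := hτ
  obtain ⟨c, n₁, hc⟩ := h
  -- for `n ≥ n₁`: `n ≤ (2^((log₂ log₂ n + c)^c) + 2)^c₀`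
  have key : ∀ n, n₁ ≤ n → n ≤ (2 ^ ((Nat.log 2 (Nat.log 2 n) + c) ^ c) + 2) ^ c₀ := by
    intro n hn
    obtain ⟨N, e, d, hN, hd, hτg⟩ := hc n hn
    -- the polynomial `g = N · (2^e · f_n)^d`
    set g : Polynomial ℤ := C N * (C ((2 : ℤ) ^ e) * pochhammerWilkinson n) ^ d
    have hg_ne : g ≠ 0 :=
      mul_ne_zero (C_ne_zero.2 hN) (pow_ne_zero _
        (mul_ne_zero (C_ne_zero.2 (pow_ne_zero _ two_ne_zero)) (pochhammerWilkinson_ne_zero n)))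
    have hdvd : pochhammerWilkinson n ∣ g :=
      (dvd_pow (dvd_mul_left (pochhammerWilkinson n) (C ((2 : ℤ) ^ e))) (by omega)).mul_left _
    -- `g` has at least the `n` distinct integer roots `1, …, n`
    have hle : (pochhammerWilkinson n).roots ≤ g.roots := roots.le_of_dvd hg_ne hdvd
    calc n = (pochhammerWilkinson n).roots.toFinset.card :=
          (card_roots_toFinset_pochhammerWilkinson n).symm
      _ ≤ g.roots.toFinset.card :=
          Finset.card_le_card (Multiset.toFinset_subset.2 (Multiset.subset_of_le hle))
      _ ≤ (tauPoly g + 2) ^ c₀ := hc₀ g hg_ne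
      _ ≤ (2 ^ ((Nat.log 2 (Nat.log 2 n) + c) ^ c) + 2) ^ c₀ :=
          Nat.pow_le_pow_left (Nat.add_le_add_right hτg 2) _
  -- contradiction at `n = 2^(2^k)`, `k ≥ n₁` large
  obtain ⟨k, hk, hlt⟩ := tbd_exists_ge_two_pow_pow_add_two_pow_lt c c₀ n₁
  have hlog : Nat.log 2 (Nat.log 2 (2 ^ (2 ^ k))) = k := by
    rw [Nat.log_pow (by norm_num), Nat.log_pow (by norm_num)]
  have hn₁ : n₁ ≤ 2 ^ (2 ^ k) :=
    hk.trans ((Nat.lt_two_pow_self).le.trans (Nat.lt_two_pow_self).le)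
  have hkey := key (2 ^ (2 ^ k)) hn₁
  rw [hlog] at hkey
  exact absurd hkey (not_le.2 hlt)

end Summit.ValiantsHypothesis.ValiantsHypothesis.Theorems.IntegralOrbitsTauBurgisserDet
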